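import Mathlib.Algebra.BigOperators.Finprod
import Mathlib.Data.Complex.Basic
import Mathlib.SetTheory.Cardinal.Finite
import HarnessLib

/-!
# Kottwitz (1986) §9: stabilization of the elliptic terms in the trace formula — `T_e(f)`, `ST_e(f)`, the assumptions
# of 9.3, `ι(G, H)`, THEOREM 9.6 `T_e*(f) = Σ_{(H,s,η) ∈ 𝔈} ι(G, H) ST_e**(f^H)`, the displays (9.3.1), (9.6.1)–(9.6.4), and
# LEMMA 9.7 — as a LETTER: one posited datum, the printed statements as relations over it, nothing asserted
(R. E. Kottwitz, *Stable trace formula: elliptic singular terms*, Math. Ann. 275 (1986) 365–399, §9 pp. 391–397)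

Topic `NumberTheory/Kottwitz1986`; namespace `Literature.NumberTheory.Kottwitz1986.Stabilization`.  STATEMENTS ONLY: one
`structure StabilizationData` (every field a bare carrier, map or predicate with its page pin), definitions WITH BODIES for the
four sums the print defines (`Te`, `TeStar`, `STe`, `STeStarStar`), and `Prop`-valued relations (one `def` per printed statement,
verbatim numbering).  No theorem, no proof, no `sorry`, no `axiom`, no instance, no notation.  ED. 2∕3 (2026-09-02): the relation `SumsFinite`
now lists the finiteness of EVERY support summed or counted in §9 (squad rule D5, QA NB-1); every other declaration byte-identical.  Cell hodgecm-mathlib, carpet squad TK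
(seat TK-t06); the sibling carpets of §§1–8 and §10 posit their own vocabularies (squad ruling V3).  The tree's `adelicOrbitalIntegral`,
`adelicStableOrbitalIntegralG`, `tamagawaNumberAt`, `kerOne`, `StableClass` are `U(3)`∕Rogawski-specialised readings of this section
([Rogawski1990] files citing «Kottwitz1986, §9»); the general connected reductive `G` of the print is POSITED here.  HC_CM is proved
only modulo the printed citations until rung 0 closes; nothing here is about HC.

## Source (open-access digitisation GDZ PPN235181684_0275 LOG_0056, store key `paper:url-ecbc59a1db27`; page images canvas = printed
## page + 6; read from the images of pp. 391–397)

[9.1 p. 391] «In this section `F` is a number field and `G` is a connected reductive group over `F`. We use the canonical Haar measure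
`dg` on `G(𝔸)` (the one used in the definition of the Tamagawa number of `G`). For `f ∈ C_c^∞(G(𝔸))` we write `T_e(f)` for the
elliptic part of the trace formula [A] for `f`: `T_e(f) = Σ_{γ ∈ E} |G_γ(F)/I(F)|⁻¹ τ(I) O_γ(f)`,» [p. 392] «where `E` is a set of
representatives for the elliptic semi-simple conjugacy classes in `G(F)`, `I` is the identity component of `G_γ`, `τ(I)` is the Tamagawa
number of `I`, and `O_γ(f)` is the adelic orbital integral `∫_{I(𝔸)\G(𝔸)} f(g⁻¹γg) dg/di`. … The first is that `γ` is elliptic if and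
only if `γ` belongs to some elliptic maximal `F`-torus of `G`. The second is that `γ` is elliptic if and only if `Z(I)⁰/Z(G)⁰` is
anisotropic. If every connected reductive `F`-group possesses elliptic maximal `F`-tori (e.g., if `F` is a number field or a `p`-adic
field), then the two definitions are equivalent».  [9.2 p. 392] «For quasi-split `G` we define the stable analogue `ST_e(f)` of `T_e(f)`
by the formula `ST_e(f) = Σ_{γ ∈ E_st} |(G_γ/I)(F)|⁻¹ τ(G) SO_γ(f)`, where `E_st` is a set of representatives for the elliptic semi-simple
stable conjugacy classes in `G(F)`, and `SO_γ(f)` is the stable adelic orbital integral `SO_γ(f) = Σ_i e(γ_i) O_{γ_i}(f)` … The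
finiteness results of Sects. 7 and 8 show that the sums defining `SO_γ(f)` and `ST_e(f)` have only a finite number of non-zero terms. …
`SO_γ(f)` and `|(G_γ/I)(F)|` depend only on the stable conjugacy class of `γ`».  [9.3 pp. 392–393] «From now on we simplify the
discussion by assuming that `G_der` is simply connected. We choose an inner twisting `ψ : G₀ → G` with `G₀` quasi-split over `F`. We also
choose a set `𝔈` of representatives for the isomorphism classes of elliptic endoscopic triples `(H, s, η)` for `G` [K3], and for each
`(H, s, η) ∈ 𝔈` we choose an `L`-homomorphism `η′ : ᴸH → ᴸG` extending `η`. … First of all we assume the local and global [hypotheses] in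
Sects. 5 and 6. We also assume that the "fundamental lemma" [L2, Chap. III] on spherical functions holds for `G, H` at places `v` where
both groups are unramified (for our purposes it is enough to have the fundamental lemma for the unit element in the Hecke algebra of `G`).
With these assumptions the local function correspondences of Sect. 5 yield functions `f^H ∈ C_c^∞(H(𝔸))` … and these functions have
the property that (9.3.1) `SO_{γ_H}(f^H) = Σ_γ ⟨obs(γ), κ⟩ e(γ) O_γ(f)` for any `(G, H)`-regular semi-simple `γ_H ∈ H(F)`. In the sum
`γ` runs over a set of representatives for the `G(𝔸)`-conjugacy classes in `G(𝔸)` that come from `γ_H`. … `e(γ) = Π_v e(I_v)` …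
We will need the Hasse principle and therefore we assume that `G` has no `E₈` factors. Finally, we assume that Weil's [statement] on
Tamagawa numbers is true for all groups `I` whose dimension is less than that of `G` … `τ(I_sc) = 1`.»  [9.4 p. 393] «To any elliptic
endoscopic triple `(H, s, η)` of `G` there is associated a number `ι(G, H)` [L2]. … `ι(G, H) = τ₁(G) · τ₁(H)⁻¹ · λ⁻¹`. Here `τ₁(G)`
denotes the relative Tamagawa number `τ(G)/τ(G_sc)` of `G`, and `λ` denotes the cardinality of the group `Aut(H, s, η)/H_ad(F)`».
[9.5 p. 393] «We define `T_e*(f)` by the sum used to define `T_e(f)`, omitting all terms indexed by central elements `γ` of `G(F)`.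
Similarly we define `ST_e**(f^H)` by omitting certain terms from the sum defining `ST_e(f^H)`. If `H` is a quasi-split inner form of `G`,
we omit all terms indexed by central elements `γ_H` of `H(F)`. If `H` is not a quasi-split inner form of `G`, then we omit all terms
indexed by elements `γ_H ∈ H(F)` that are not `(G, H)`-regular.»  **9.6. THEOREM** (p. 393): «Under the assumptions of 9.3 we have
`T_e*(f) = Σ_{(H,s,η) ∈ 𝔈} ι(G, H) ST_e**(f^H)`.»  [p. 394] (9.6.1) «Choose a set `E₀*` of representatives for the non-central elliptic
semi-simple stable conjugacy classes in `G₀(F)`. Then `T_e*(f) = Σ_{γ₀ ∈ E₀*} τ(I₀) Σ_γ O_γ(f)` where `I₀` is the (connected) centralizer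
of `γ₀` in `G₀` and the second sum runs over a set of representatives `γ` for the `G(F)`-conjugacy classes in `G(F)` contained in the
`G(F̄)`-conjugacy class of `ψ(γ₀)`. … `τ(I) = τ(I₀)`»; (9.6.2) «the number of terms in the second sum in (9.6.1) that are indexed by
`G(𝔸)`-conjugates of `γ` is equal to `|ker[ker¹(F, I) → ker¹(F, G)]|`»; (9.6.3) «Using that `Z(Î₀) = Z(Î)`, … is equal to
`|cok[ker¹(F, Z(Ĝ)) → ker¹(F, Z(Î₀))]|`»; [p. 395] (9.6.4) «Theorem 6.6 implies that `|𝔎(I₀/F)|⁻¹ Σ_κ ⟨obs(γ), κ⟩`, where `κ` runs over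
`𝔎(I₀/F)`, is equal to `1` if the `G(𝔸)`-conjugacy class of `γ` contains an element of `G(F)` and is equal to `0` otherwise»; «If `γ` is
`G(𝔸)`-conjugate to an element of `G(F)`, then the last result in [K2] says that `e(γ) = 1`»; «the quotient of the number (9.6.3) by
`|𝔎(I₀/F)|` is equal to `τ₁(G) · τ₁(I₀)⁻¹`».  [p. 396] «To indicate that `(γ₀, κ)` are obtained from `(H, s, η, γ_H)` in this way we write
`(H, s, η, γ_H) → (γ₀, κ)`.»  **9.7. LEMMA** (p. 396): «Let `γ₀` be any elliptic semi-simple element of `G₀(F)` and let `κ ∈ 𝔎(I₀/F)`,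
where `I₀ = (G₀)_{γ₀}`. Then there exist `(H, s, η) ∈ 𝔈` and a `(G, H)`-regular semi-simple element `γ_H` of `H(F)` such that
`(H, s, η, γ_H) → (γ₀, κ)`. Moreover, `(H₁, s₁, η₁, γ_{H₁}) → (γ₀, κ)` also holds if and only if there exists an isomorphism
`(H, s, η) → (H₁, s₁, η₁)` carrying `γ_H` into a stable conjugate of `γ_{H₁}`, and such an isomorphism is unique up to composition with an
element of `H_ad(F)`.»

## What is typed, and how

* `StabilizationData` — ONE posited datum: test functions on `G(𝔸)` and `H(𝔸)`, the semisimple elements of `G(F)`, `H(F)`, `G₀(F)` as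
  carriers with the printed predicates (elliptic in both senses, central, `(G,H)`-regular, conjugate, stably conjugate), the sets of
  representatives `E`, `E_st`, `E₀*` AS DATA (their defining properties are relations), the numbers `|G_γ(F)/I(F)|`, `τ(I)`, `τ(H)`,
  `τ₁`, `λ`, `ι(G, H)`, `|ker[…]|`, `|cok[…]|` as maps, the functionals `O_γ`, `SO_{γ_H}`, `f ↦ f^H`, `⟨obs(γ), κ⟩`, `e(γ)`, the group
  `𝔎(I₀/F)`, the arrow `(H, s, η, γ_H) → (γ₀, κ)`, isomorphisms of endoscopic triples and `H_ad(F)`, and the five assumptions of 9.3 as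
  `Prop` fields.  Nothing in the structure asserts a printed statement (squad ruling V1).
* DEFINED over it (bodies; `finsum`s, junk `0` on infinite support — the print's finiteness is the relation `SumsFinite`): **`Te`**,
  **`TeStar`**, **`STe`**, `Omit`, **`STeStarStar`**, `rationalAverage` (the left side of (9.6.4)), `Assumptions93`.
* RELATIONS: `EllipticDefsAgree` (9.1), `RepSpec`, `StRepSpecH`, `ClassFunction` (9.2 «depend only on the stable conjugacy class»),
  `SumsFinite`, **`Eq931`**, **`IotaFormula`** (9.4), **`Kottwitz1986_9_6`** (THEOREM 9.6), `Eq961`, `TauInnerTwist`, `Eq962`, `Eq963`,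
  **`Eq964`**, `ESignOne`, `QuotientTau1`, **`Kottwitz1986_9_7_exists`**, **`Kottwitz1986_9_7_iff`**, **`Kottwitz1986_9_7_unique`**.
NOT typed here: the measures and integrals themselves (posited functionals), `obs(γ)` and Theorem 6.6 (the §6 carpet),
Prop. 7.1 ∕ Cor. 7.3 ∕ Prop. 8.2 (carpets `LocalFiniteness`, `GlobalFiniteness`), the exact sequence of p. 395 and the rearrangements
(9.6.5)–(9.6.6) of the proof, and §10 (carpet `EllipticTori`).
-/

namespace Literature.NumberTheory.Kottwitz1986.Stabilization

universe u

/-! ## §1 The posited datum of §9 -/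

/-- **The data of Kottwitz's §9 AS A DATUM.**  Behind it (not fields): a number field `F`, a connected reductive `F`-group `G` with
`G_der` simply connected or not (the assumption is the field `DerSimplyConnected`), the canonical (Tamagawa) measures, an inner twisting
`ψ : G₀ → G` with `G₀` quasi-split, the set `𝔈` of representatives of the isomorphism classes of elliptic endoscopic triples `(H, s, η)` with
chosen `η′ : ᴸH → ᴸG` (9.3).  Every field is a bare carrier, a map or a predicate with its page pin; no field asserts a printed statement.
[cite: Kottwitz1986, §9 (pp. 391–396)] -/
structure StabilizationData : Type (u + 1) where
  /-- `C_c^∞(G(𝔸))` [9.1 p. 391] -/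
  Test : Type u
  /-- the semisimple elements `γ` of `G(F)` [9.1 pp. 391–392] -/
  SS : Type u
  /-- conjugacy in `G(F)` [9.1 p. 392] -/
  IsConj : SS → SS → Prop
  /-- «`γ` belongs to some elliptic maximal `F`-torus of `G`» (first definition of elliptic) [9.1 p. 392] -/
  InEllipticTorus : SS → Prop
  /-- «`Z(I)⁰/Z(G)⁰` is anisotropic», `I = (G_γ)⁰` (second definition of elliptic) [9.1 p. 392] -/
  CenterQuotAnisotropic : SS → Prop
  /-- `γ` is central in `G` [9.5 p. 393] -/
  IsCentral : SS → Prop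
  /-- `E`: a set of representatives for the elliptic semisimple conjugacy classes in `G(F)` (DATA; its property is `RepSpec`) [9.1 p. 392] -/
  EllRep : Set SS
  /-- `|G_γ(F)/I(F)|`, `I` the identity component of `G_γ` [9.1 p. 391] -/
  index : SS → ℕ
  /-- `τ(I)`, the Tamagawa number of `I = (G_γ)⁰` [9.1 p. 392] -/
  tau : SS → ℝ
  /-- `O_γ(f) = ∫_{I(𝔸)\G(𝔸)} f(g⁻¹γg) dg/di` (canonical measures) [9.1 p. 392] -/
  orb : SS → Test → ℂ
  /-- `𝔈`: the chosen representatives of the isomorphism classes of elliptic endoscopic triples `(H, s, η)` [9.3 p. 392] -/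
  Endo : Type u
  /-- `C_c^∞(H(𝔸))` [9.3 p. 393] -/
  TestH : Endo → Type u
  /-- `f ↦ f^H` («as usual we write `f^H` even though `f^H` also depends on `s, η′`») [9.3 p. 393] -/
  transfer : (e : Endo) → Test → TestH e
  /-- the semisimple elements `γ_H` of `H(F)` [9.2 p. 392; 9.3 p. 393] -/
  SSH : Endo → Type u
  /-- stable conjugacy in `H(F)` [9.2 p. 392] -/
  IsStConjH : (e : Endo) → SSH e → SSH e → Prop
  /-- `γ_H` elliptic in `H` [9.2 p. 392] -/
  IsEllipticH : (e : Endo) → SSH e → Prop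
  /-- `γ_H` central in `H` [9.5 p. 393] -/
  IsCentralH : (e : Endo) → SSH e → Prop
  /-- `γ_H` is `(G, H)`-regular [§3; 9.3 p. 393] -/
  IsGHRegular : (e : Endo) → SSH e → Prop
  /-- `E_st` for `H`: representatives of the elliptic semisimple stable conjugacy classes in `H(F)` (DATA; property `StRepSpecH`) [9.2 p. 392] -/
  EllStRepH : (e : Endo) → Set (SSH e)
  /-- `|(H_{γ_H}/I_H)(F)|` [9.2 p. 392] -/
  indexH : (e : Endo) → SSH e → ℕ
  /-- `τ(H)` [9.2 p. 392] -/
  tauH : Endo → ℝ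
  /-- `SO_{γ_H}(f^H) = Σ_i e(γ_{H,i}) O_{γ_{H,i}}(f^H)`, the stable adelic orbital integral on `H` [9.2 p. 392] -/
  stOrbH : (e : Endo) → SSH e → TestH e → ℂ
  /-- «`H` is a quasi-split inner form of `G`» [9.5 p. 393] -/
  IsQuasiSplitInnerForm : Endo → Prop
  /-- `ι(G, H)` [9.4 p. 393] -/
  iota : Endo → ℝ
  /-- `τ₁(G) = τ(G)/τ(G_sc)` [9.4 p. 393] -/
  tau1G : ℝ
  /-- `τ₁(H)` [9.4 p. 393] -/
  tau1H : Endo → ℝ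
  /-- `λ = |Aut(H, s, η)/H_ad(F)|` [9.4 p. 393] -/
  lam : Endo → ℕ
  /-- representatives `γ` of the `G(𝔸)`-conjugacy classes in `G(𝔸)` that come from `γ_H` [9.3 p. 393] -/
  AdFrom : (e : Endo) → SSH e → Type u
  /-- `⟨obs(γ), κ⟩` for such `γ` («explained in 6.9») [9.3 p. 393] -/
  obsPair : {e : Endo} → {γH : SSH e} → AdFrom e γH → ℂ
  /-- `e(γ) = Π_v e(I_v)`, `I_v` the connected centralizer in `G_v` of the `v`-component of `γ` [9.3 p. 393] -/
  eSign : {e : Endo} → {γH : SSH e} → AdFrom e γH → ℤ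
  /-- `O_γ(f)` for `γ ∈ G(𝔸)` coming from `γ_H` [9.3 p. 393] -/
  orbA : {e : Endo} → {γH : SSH e} → AdFrom e γH → Test → ℂ
  /-- «`G_der` is simply connected» [9.3 p. 392] -/
  DerSimplyConnected : Prop
  /-- «the local and global [hypotheses] in Sects. 5 and 6» (5.3, 5.5 at every place; 6.10) [9.3 p. 393] -/
  LocalGlobalHypotheses : Prop
  /-- the fundamental lemma for the unit of the Hecke algebra at the places where `G`, `H` are unramified [9.3 p. 393] -/
  FundamentalLemmaUnit : Prop
  /-- «`G` has no `E₈` factors» (Hasse principle) [9.3 p. 393] -/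
  NoE8 : Prop
  /-- Weil's `τ(I_sc) = 1` for all groups `I` of dimension less than `dim G` [9.3 p. 393] -/
  WeilTamagawaBelow : Prop
  /-- the semisimple elements `γ₀` of `G₀(F)` [9.6 p. 394; 9.7 p. 396] -/
  SS0 : Type u
  /-- `γ₀` elliptic in `G₀` [9.6 p. 394] -/
  IsElliptic0 : SS0 → Prop
  /-- `γ₀` central [9.6 p. 394] -/
  IsCentral0 : SS0 → Prop
  /-- `E₀*`: representatives of the non-central elliptic semisimple STABLE conjugacy classes in `G₀(F)` (DATA) [9.6 p. 394] -/
  EllStRep0 : Set SS0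
  /-- `τ(I₀)`, `I₀ = (G₀)_{γ₀}` [9.6 p. 394] -/
  tau0 : SS0 → ℝ
  /-- `τ₁(I₀)` [9.6 p. 395] -/
  tau1I0 : SS0 → ℝ
  /-- representatives `γ` of the `G(F)`-conjugacy classes in `G(F)` inside the `G(F̄)`-conjugacy class of `ψ(γ₀)` [9.6 p. 394] -/
  RatClass0 : SS0 → Type u
  /-- such a representative as a semisimple element of `G(F)` [9.6 p. 394] -/
  ratToSS : {γ₀ : SS0} → RatClass0 γ₀ → SS
  /-- representatives of the `G(𝔸)`-conjugacy classes in `G(𝔸)` inside the `G(𝔸̄)`-conjugacy class of `ψ(γ₀)` [9.6 pp. 394–395] -/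
  AdClass0 : SS0 → Type u
  /-- the `G(𝔸)`-class of a rational class [9.6 p. 394] -/
  toAd : {γ₀ : SS0} → RatClass0 γ₀ → AdClass0 γ₀
  /-- «the `G(𝔸)`-conjugacy class of `γ` contains an element of `G(F)`» [9.6 p. 395] -/
  HasRationalPoint : {γ₀ : SS0} → AdClass0 γ₀ → Prop
  /-- `|ker[ker¹(F, I) → ker¹(F, G)]|`, `I` the connected centralizer of the rational `γ` [9.6 (9.6.2) p. 394] -/
  cardKerKer1 : {γ₀ : SS0} → RatClass0 γ₀ → ℕ
  /-- `|cok[ker¹(F, Z(Ĝ)) → ker¹(F, Z(Î₀))]|` [9.6 (9.6.3) p. 394] -/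
  cardCokKer1Z : SS0 → ℕ
  /-- `𝔎(I₀/F)`, `I₀ = (G₀)_{γ₀}` [§4; 9.6 p. 395; 9.7 p. 396] -/
  KGroup : SS0 → Type u
  /-- `⟨obs(γ), κ⟩` for `γ ∈ G(𝔸)` in the class of `ψ(γ₀)`, `obs(γ) ∈ 𝔎(I₀/F)^D` (6.5) [9.6 pp. 394–395] -/
  obsPair0 : {γ₀ : SS0} → AdClass0 γ₀ → KGroup γ₀ → ℂ
  /-- `e(γ) = Π_v e(I_v)` for such `γ` [9.6 p. 395] -/
  eSign0 : {γ₀ : SS0} → AdClass0 γ₀ → ℤ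
  /-- «`(H, s, η, γ_H) → (γ₀, κ)`»: `(γ₀, κ)` are obtained from `(H, s, η, γ_H)` by the construction of 6.10 [9.6 p. 396] -/
  Arrow : (e : Endo) → SSH e → (γ₀ : SS0) → KGroup γ₀ → Prop
  /-- isomorphisms of endoscopic triples `(H, s, η) → (H₁, s₁, η₁)` [9.7 p. 396] -/
  Iso : Endo → Endo → Type u
  /-- the image of `γ_H ∈ H(F)` under an isomorphism [9.7 p. 396] -/
  isoAct : {e e₁ : Endo} → Iso e e₁ → SSH e → SSH e₁
  /-- `H_ad(F)` [9.7 p. 396] -/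
  HadF : Endo → Type u
  /-- composition of an isomorphism with an element of `H_ad(F)` [9.7 p. 396] -/
  compHad : {e e₁ : Endo} → Iso e e₁ → HadF e → Iso e e₁

namespace StabilizationData

variable (D : StabilizationData.{u})

/-! ## §2 Defined objects: `T_e`, `T_e*`, `ST_e`, `ST_e**`, the assumptions of 9.3 -/

/-- **`T_e(f) = Σ_{γ ∈ E} |G_γ(F)/I(F)|⁻¹ τ(I) O_γ(f)`** (a `finsum`; finitely many non-zero terms is the relation `SumsFinite`).
[cite: Kottwitz1986, §9.1 (pp. 391–392)] -/
noncomputable def Te (f : D.Test) : ℂ :=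
  ∑ᶠ γ ∈ D.EllRep, ((D.index γ : ℂ))⁻¹ * (D.tau γ : ℂ) * D.orb γ f

/-- **`T_e*(f)`**: the sum defining `T_e(f)` «omitting all terms indexed by central elements `γ` of `G(F)`».
[cite: Kottwitz1986, §9.5 (p. 393)] -/
noncomputable def TeStar (f : D.Test) : ℂ :=
  ∑ᶠ γ ∈ {γ | γ ∈ D.EllRep ∧ ¬ D.IsCentral γ}, ((D.index γ : ℂ))⁻¹ * (D.tau γ : ℂ) * D.orb γ f

/-- **`ST_e(f^H) = Σ_{γ_H ∈ E_st} |(H_{γ_H}/I_H)(F)|⁻¹ τ(H) SO_{γ_H}(f^H)`** for the quasi-split group `H` of `(H, s, η) ∈ 𝔈`.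
[cite: Kottwitz1986, §9.2 (p. 392)] -/
noncomputable def STe (e : D.Endo) (fH : D.TestH e) : ℂ :=
  ∑ᶠ γH ∈ D.EllStRepH e, ((D.indexH e γH : ℂ))⁻¹ * (D.tauH e : ℂ) * D.stOrbH e γH fH

/-- The terms OMITTED in `ST_e**`: «If `H` is a quasi-split inner form of `G`, we omit all terms indexed by central elements `γ_H` of
`H(F)`. If `H` is not a quasi-split inner form of `G`, then we omit all terms indexed by elements `γ_H ∈ H(F)` that are not
`(G, H)`-regular.» [cite: Kottwitz1986, §9.5 (p. 393)] -/
def Omit (e : D.Endo) (γH : D.SSH e) : Prop :=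
  (D.IsQuasiSplitInnerForm e ∧ D.IsCentralH e γH) ∨ (¬ D.IsQuasiSplitInnerForm e ∧ ¬ D.IsGHRegular e γH)

/-- **`ST_e**(f^H)`**: the sum defining `ST_e(f^H)` with the terms of `Omit` left out. [cite: Kottwitz1986, §9.5 (p. 393)] -/
noncomputable def STeStarStar (e : D.Endo) (fH : D.TestH e) : ℂ :=
  ∑ᶠ γH ∈ {γH | γH ∈ D.EllStRepH e ∧ ¬ D.Omit e γH}, ((D.indexH e γH : ℂ))⁻¹ * (D.tauH e : ℂ) * D.stOrbH e γH fH

/-- **The left side of (9.6.4)**: `|𝔎(I₀/F)|⁻¹ Σ_{κ ∈ 𝔎(I₀/F)} ⟨obs(γ), κ⟩` (`Nat.card`, `finsum`). [cite: Kottwitz1986, §9.6 (9.6.4) (p. 395)] -/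
noncomputable def rationalAverage {γ₀ : D.SS0} (γ : D.AdClass0 γ₀) : ℂ :=
  ((Nat.card (D.KGroup γ₀) : ℂ))⁻¹ * ∑ᶠ κ : D.KGroup γ₀, D.obsPair0 γ κ

/-- **«the assumptions of 9.3»**: `G_der` simply connected; the local and global hypotheses of §§5–6; the fundamental lemma for the unit;
no `E₈` factors; Weil's `τ(I_sc) = 1` below `dim G`. [cite: Kottwitz1986, §9.3 (pp. 392–393)] -/
def Assumptions93 : Prop :=
  D.DerSimplyConnected ∧ D.LocalGlobalHypotheses ∧ D.FundamentalLemmaUnit ∧ D.NoE8 ∧ D.WeilTamagawaBelow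

/-! ## §3 The printed statements of 9.1–9.5 as relations -/

/-- **9.1: the two definitions of «elliptic» agree** over a number field («If every connected reductive `F`-group possesses elliptic
maximal `F`-tori (e.g., if `F` is a number field or a `p`-adic field), then the two definitions are equivalent»), AS A RELATION.
[cite: Kottwitz1986, §9.1 (p. 392)] -/
def EllipticDefsAgree : Prop :=
  ∀ γ : D.SS, D.InEllipticTorus γ ↔ D.CenterQuotAnisotropic γ

/-- **«`E` is a set of representatives for the elliptic semi-simple conjugacy classes in `G(F)`»**, AS A RELATION on the datum `EllRep`.
[cite: Kottwitz1986, §9.1 (p. 392)] -/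
def RepSpec : Prop :=
  (∀ γ ∈ D.EllRep, D.InEllipticTorus γ) ∧
    ∀ γ : D.SS, D.InEllipticTorus γ → ∃ γ' ∈ D.EllRep, D.IsConj γ γ' ∧ ∀ γ'' ∈ D.EllRep, D.IsConj γ γ'' → γ'' = γ'

/-- **«`E_st` is a set of representatives for the elliptic semi-simple stable conjugacy classes in `H(F)`»** (for each `H` of `𝔈`),
AS A RELATION on the datum `EllStRepH`. [cite: Kottwitz1986, §9.2 (p. 392)] -/
def StRepSpecH : Prop :=
  ∀ e : D.Endo, (∀ γH ∈ D.EllStRepH e, D.IsEllipticH e γH) ∧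
    ∀ γH : D.SSH e, D.IsEllipticH e γH →
      ∃ γ' ∈ D.EllStRepH e, D.IsStConjH e γH γ' ∧ ∀ γ'' ∈ D.EllStRepH e, D.IsStConjH e γH γ'' → γ'' = γ'

/-- **«`SO_γ(f)` and `|(G_γ/I)(F)|` depend only on the stable conjugacy class of `γ`»** (for the quasi-split `H`), AS A RELATION.
[cite: Kottwitz1986, §9.2 (p. 392)] -/
def ClassFunction : Prop :=
  ∀ (e : D.Endo) (γH γH' : D.SSH e), D.IsStConjH e γH γH' →
    D.indexH e γH = D.indexH e γH' ∧ ∀ fH : D.TestH e, D.stOrbH e γH fH = D.stOrbH e γH' fH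

/-- **«The finiteness results of Sects. 7 and 8 show that the sums defining `SO_γ(f)` and `ST_e(f)` have only a finite number of
non-zero terms»** (p. 392), «this triple sum has only finitely many non-zero terms» (p. 395) — the finiteness of EVERY index the displays
of §9 sum or count over, AS A RELATION (so that no `finsum` ∕ `Nat.card` above takes its junk value): the supports of the sums defining
`T_e(f)`, `ST_e(f^H)`, (9.3.1) and the inner sum of (9.6.1) are finite; for each `f` only finitely many `(H, s, η) ∈ 𝔈` have
`ST_e**(f^H) ≠ 0` (the right side of Theorem 9.6 has finitely many non-zero terms, p. 395 — `𝔈` itself may be infinite); the group `𝔎(I₀/F)` of (9.6.4) is finite (the print divides by `|𝔎(I₀/F)|`); the set counted in (9.6.2) is finite (the print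
equates its cardinality with `|ker[ker¹(F, I) → ker¹(F, G)]|`).  ED. 2 listed the finiteness clauses beyond the first three; ED. 3
replaces ED. 2's «`𝔈` finite» (stronger than the print: `𝔈` is infinite for `G = SL₂`) by the support condition (squad QA NB-1).
[cite: Kottwitz1986, §9.2 (p. 392), §9.6 (pp. 394–395)] -/
def SumsFinite : Prop :=
  (∀ f : D.Test, {γ | γ ∈ D.EllRep ∧ D.orb γ f ≠ 0}.Finite) ∧
    (∀ (e : D.Endo) (fH : D.TestH e), {γH | γH ∈ D.EllStRepH e ∧ D.stOrbH e γH fH ≠ 0}.Finite) ∧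
    (∀ (e : D.Endo) (γH : D.SSH e) (f : D.Test), {γ : D.AdFrom e γH | D.orbA γ f ≠ 0}.Finite) ∧
    (∀ (γ₀ : D.SS0) (f : D.Test), {γ : D.RatClass0 γ₀ | D.orb (D.ratToSS γ) f ≠ 0}.Finite) ∧
    (∀ f : D.Test, {γ₀ | γ₀ ∈ D.EllStRep0 ∧ ∑ᶠ γ : D.RatClass0 γ₀, D.orb (D.ratToSS γ) f ≠ 0}.Finite) ∧
    (∀ f : D.Test, {e : D.Endo | D.STeStarStar e (D.transfer e f) ≠ 0}.Finite) ∧ (∀ γ₀ ∈ D.EllStRep0, Finite (D.KGroup γ₀)) ∧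
    ∀ γ₀ ∈ D.EllStRep0, ∀ γ : D.RatClass0 γ₀, Finite {γ' : D.RatClass0 γ₀ // D.toAd γ' = D.toAd γ}

/-- **(9.3.1)**: «`SO_{γ_H}(f^H) = Σ_γ ⟨obs(γ), κ⟩ e(γ) O_γ(f)` for any `(G, H)`-regular semi-simple `γ_H ∈ H(F)`. In the sum `γ` runs over a
set of representatives for the `G(𝔸)`-conjugacy classes in `G(𝔸)` that come from `γ_H`» — the property of the functions `f^H` that the
assumptions of 9.3 yield, AS A RELATION. [cite: Kottwitz1986, §9.3 (9.3.1) (p. 393)] -/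
def Eq931 : Prop :=
  D.Assumptions93 → ∀ (e : D.Endo) (γH : D.SSH e), D.IsGHRegular e γH → ∀ f : D.Test,
    D.stOrbH e γH (D.transfer e f) = ∑ᶠ γ : D.AdFrom e γH, D.obsPair γ * (D.eSign γ : ℂ) * D.orbA γ f

/-- **9.4: «`ι(G, H) = τ₁(G) · τ₁(H)⁻¹ · λ⁻¹`»** (the formula of Sect. 8 of [K3], recalled), AS A RELATION. [cite: Kottwitz1986, §9.4 (p. 393)] -/
def IotaFormula : Prop :=
  ∀ e : D.Endo, D.iota e = D.tau1G * (D.tau1H e)⁻¹ * ((D.lam e : ℝ))⁻¹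

/-! ## §4 THEOREM 9.6 and the displays of its proof -/

/-- **9.6. THEOREM**: «Under the assumptions of 9.3 we have `T_e*(f) = Σ_{(H,s,η) ∈ 𝔈} ι(G, H) ST_e**(f^H)`.» — AS A RELATION over the
datum (the sum over `𝔈` as a `finsum`). [cite: Kottwitz1986, Theorem 9.6 (p. 393)] -/
def Kottwitz1986_9_6 : Prop :=
  D.Assumptions93 → ∀ f : D.Test, D.TeStar f = ∑ᶠ e : D.Endo, (D.iota e : ℂ) * D.STeStarStar e (D.transfer e f)

/-- **(9.6.1)**: «`T_e*(f) = Σ_{γ₀ ∈ E₀*} τ(I₀) Σ_γ O_γ(f)`», the inner sum over representatives `γ` of the `G(F)`-conjugacy classes in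
`G(F)` contained in the `G(F̄)`-conjugacy class of `ψ(γ₀)` (uses `G_γ = I`, `|G_γ(F)/I(F)| = 1` and `τ(I) = τ(I₀)`), AS A RELATION.
[cite: Kottwitz1986, §9.6 (9.6.1) (p. 394)] -/
def Eq961 : Prop :=
  D.Assumptions93 → ∀ f : D.Test,
    D.TeStar f = ∑ᶠ γ₀ ∈ D.EllStRep0, (D.tau0 γ₀ : ℂ) * ∑ᶠ γ : D.RatClass0 γ₀, D.orb (D.ratToSS γ) f

/-- **«`τ(I) = τ(I₀)` (this follows from Weil's [statement] for `I`, since one knows that the relative Tamagawa numbers of `I, I₀` are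
equal)»**: under the assumptions of 9.3, for every non-central elliptic `γ₀ ∈ E₀*` and every rational class `γ` under `ψ(γ₀)`, AS A RELATION.
[cite: Kottwitz1986, §9.6 (p. 394)] -/
def TauInnerTwist : Prop :=
  D.Assumptions93 → ∀ γ₀ ∈ D.EllStRep0, ∀ γ : D.RatClass0 γ₀, D.tau (D.ratToSS γ) = D.tau0 γ₀

/-- **(9.6.2)**: «the number of terms in the second sum in (9.6.1) that are indexed by `G(𝔸)`-conjugates of `γ` is equal to
`|ker[ker¹(F, I) → ker¹(F, G)]|`» (`G` with no `E₈` factors), AS A RELATION. [cite: Kottwitz1986, §9.6 (9.6.2) (p. 394)] -/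
def Eq962 : Prop :=
  D.Assumptions93 → ∀ γ₀ ∈ D.EllStRep0, ∀ γ : D.RatClass0 γ₀,
    Nat.card {γ' : D.RatClass0 γ₀ // D.toAd γ' = D.toAd γ} = D.cardKerKer1 γ

/-- **(9.6.3)**: «Using that `Z(Î₀) = Z(Î)`, we now see that the number of terms in the second sum in (9.6.1) that are indexed by
`G(𝔸)`-conjugates of `γ` is equal to `|cok[ker¹(F, Z(Ĝ)) → ker¹(F, Z(Î₀))]|`», AS A RELATION. [cite: Kottwitz1986, §9.6 (9.6.3) (p. 394)] -/
def Eq963 : Prop :=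
  D.Assumptions93 → ∀ γ₀ ∈ D.EllStRep0, ∀ γ : D.RatClass0 γ₀,
    Nat.card {γ' : D.RatClass0 γ₀ // D.toAd γ' = D.toAd γ} = D.cardCokKer1Z γ₀

/-- **(9.6.4)**: «Theorem 6.6 implies that `|𝔎(I₀/F)|⁻¹ Σ_κ ⟨obs(γ), κ⟩` … is equal to `1` if the `G(𝔸)`-conjugacy class of `γ` contains an
element of `G(F)` and is equal to `0` otherwise» (for `γ₀ ∈ E₀*`, `γ ∈ G(𝔸)` in the class of `ψ(γ₀)`; `G` with no `E₈` factors), AS A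
RELATION. [cite: Kottwitz1986, §9.6 (9.6.4) (p. 395)] -/
def Eq964 : Prop :=
  D.Assumptions93 → ∀ γ₀ ∈ D.EllStRep0, ∀ γ : D.AdClass0 γ₀,
    (D.HasRationalPoint γ → D.rationalAverage γ = 1) ∧ (¬ D.HasRationalPoint γ → D.rationalAverage γ = 0)

/-- **«If `γ` is `G(𝔸)`-conjugate to an element of `G(F)`, then the last result in [K2] says that `e(γ) = 1`»**, AS A RELATION.
[cite: Kottwitz1986, §9.6 (p. 395)] -/
def ESignOne : Prop :=
  ∀ (γ₀ : D.SS0) (γ : D.AdClass0 γ₀), D.HasRationalPoint γ → D.eSign0 γ = 1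

/-- **«the quotient of the number (9.6.3) by `|𝔎(I₀/F)|` is equal to `τ₁(G) · τ₁(I₀)⁻¹`»** (`γ₀` elliptic, via the exact sequence
`1 → π₀(Z(Ĝ)^Γ) → π₀(Z(Î₀)^Γ) → 𝔎(I₀/F) → ker¹(F, Z(Ĝ)) → ker¹(F, Z(Î₀))`), AS A RELATION. [cite: Kottwitz1986, §9.6 (p. 395)] -/
def QuotientTau1 : Prop :=
  D.Assumptions93 → ∀ γ₀ ∈ D.EllStRep0,
    (D.cardCokKer1Z γ₀ : ℝ) / (Nat.card (D.KGroup γ₀) : ℝ) = D.tau1G * (D.tau1I0 γ₀)⁻¹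

/-! ## §5 LEMMA 9.7 -/

/-- **9.7. LEMMA (existence)**: «Let `γ₀` be any elliptic semi-simple element of `G₀(F)` and let `κ ∈ 𝔎(I₀/F)`, where `I₀ = (G₀)_{γ₀}`. Then
there exist `(H, s, η) ∈ 𝔈` and a `(G, H)`-regular semi-simple element `γ_H` of `H(F)` such that `(H, s, η, γ_H) → (γ₀, κ)`.» — under the
standing assumption of 9.3 that `G_der` is simply connected (used on p. 397), AS A RELATION. [cite: Kottwitz1986, Lemma 9.7 (p. 396)] -/
def Kottwitz1986_9_7_exists : Prop :=
  D.DerSimplyConnected → ∀ γ₀ : D.SS0, D.IsElliptic0 γ₀ → ∀ κ : D.KGroup γ₀,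
    ∃ (e : D.Endo) (γH : D.SSH e), D.IsGHRegular e γH ∧ D.Arrow e γH γ₀ κ

/-- **9.7. LEMMA (`Moreover`)**: given `(H, s, η, γ_H) → (γ₀, κ)`, «`(H₁, s₁, η₁, γ_{H₁}) → (γ₀, κ)` also holds if and only if there exists an
isomorphism `(H, s, η) → (H₁, s₁, η₁)` carrying `γ_H` into a stable conjugate of `γ_{H₁}`» (`γ_{H₁}` a `(G, H₁)`-regular semisimple element of
`H₁(F)`), AS A RELATION. [cite: Kottwitz1986, Lemma 9.7 (p. 396)] -/
def Kottwitz1986_9_7_iff : Prop :=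
  D.DerSimplyConnected → ∀ γ₀ : D.SS0, D.IsElliptic0 γ₀ → ∀ (κ : D.KGroup γ₀) (e e₁ : D.Endo) (γH : D.SSH e) (γH₁ : D.SSH e₁),
    D.IsGHRegular e γH → D.Arrow e γH γ₀ κ → D.IsGHRegular e₁ γH₁ →
      (D.Arrow e₁ γH₁ γ₀ κ ↔ ∃ φ : D.Iso e e₁, D.IsStConjH e₁ (D.isoAct φ γH) γH₁)

/-- **9.7. LEMMA (uniqueness)**: «and such an isomorphism is unique up to composition with an element of `H_ad(F)`», AS A RELATION.
[cite: Kottwitz1986, Lemma 9.7 (p. 396)] -/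
def Kottwitz1986_9_7_unique : Prop :=
  D.DerSimplyConnected → ∀ γ₀ : D.SS0, D.IsElliptic0 γ₀ → ∀ (κ : D.KGroup γ₀) (e e₁ : D.Endo) (γH : D.SSH e) (γH₁ : D.SSH e₁),
    D.IsGHRegular e γH → D.Arrow e γH γ₀ κ → D.IsGHRegular e₁ γH₁ →
      ∀ φ φ' : D.Iso e e₁, D.IsStConjH e₁ (D.isoAct φ γH) γH₁ → D.IsStConjH e₁ (D.isoAct φ' γH) γH₁ →
        ∃ h : D.HadF e, φ' = D.compHad φ h

/-- The conjunction of the §9 relations (what a consumer of THEOREM 9.6 takes as ONE hypothesis, next to `Assumptions93`).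
[cite: Kottwitz1986, §9 (pp. 391–396)] -/
def PrintedLaws9 : Prop :=
  D.EllipticDefsAgree ∧ D.RepSpec ∧ D.StRepSpecH ∧ D.ClassFunction ∧ D.SumsFinite ∧ D.Eq931 ∧ D.IotaFormula ∧
    D.Kottwitz1986_9_6 ∧ D.Eq961 ∧ D.TauInnerTwist ∧ D.Eq962 ∧ D.Eq963 ∧ D.Eq964 ∧ D.ESignOne ∧ D.QuotientTau1 ∧
    D.Kottwitz1986_9_7_exists ∧ D.Kottwitz1986_9_7_iff ∧ D.Kottwitz1986_9_7_unique

end StabilizationData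

end Literature.NumberTheory.Kottwitz1986.Stabilization
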